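import Literature.Combinatorics.Additive.EntropicRuzsaDistance
import HarnessLib

/-!
# The entropic Balog–Szemerédi–Gowers lemma (Gowers–Green–Manners–Tao, Lemma A.2)

Topic `Literature/Combinatorics/Additive`. Everything in this file is PROVED. One theorem,
`EntropicRuzsa.ent_bsg`: for a `G²`-valued random variable `(A, B)` on a finite weighted set
(elementary abelian `2`-group `G`) and `Z = A + B`,

  `∑_z P(Z = z) d[(A | Z = z) ; (B | Z = z)] ≤ 3 I[A : B] + 2 H[Z] - H[A] - H[B]`

(GGMT, *On a conjecture of Marton*, Ann. of Math. 201 (2025), Lemma A.2 — the variant of Tao's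
entropic Balog–Szemerédi–Gowers lemma with the constants used in the endgame, GGMT Lemma 7.2).

The proof is the printed one. The two *conditionally independent trials* `(A₁, B₁), (A₂, B₂)`
of `(A, B)` relative to `Z` are realised on the index set `Ω = {(i, j) ∈ s × s : Z i = Z j}` with
weights `w i · w j / w({Z = Z i})`; Part I of the proof checks the bookkeeping (its fibres over
`Z` are the squares of the fibres of `s` with rescaled product weights, its `Z`-law and the laws
of first/second-trial variables are the original ones, conditional entropies given `Z` are
averages over product fibres — this is (A.15) of the paper), and Part II is the submodularity
computation (A.16)–(A.20). In (A.20) the printed `≤ H[A] - H[B]` is a typo for `H[A] + H[B]`.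

## References
* W. T. Gowers, B. Green, F. Manners, T. Tao, *On a conjecture of Marton*, Ann. of Math. (2)
  201 (2025), Appendix A, Lemma A.2.
* T. Tao, *Sumset and inverse sumset theory for Shannon entropy*, CPC 19 (2010) (the original
  entropic BSG lemma).
-/

open Finset Real Literature.Probability.Entropy.FiniteShannon

noncomputable section

namespace Literature.Combinatorics.Additive

namespace EntropicRuzsa

universe u

variable {G : Type u} [AddCommGroup G] [Fintype G] [DecidableEq G] [Module (ZMod 2) G]
  {ι : Type*} {s : Finset ι} {w : ι → ℝ} {A B : ι → G}

/-- **The entropic Balog–Szemerédi–Gowers lemma** (GGMT Lemma A.2, characteristic two): for a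
`G²`-valued random variable `(A, B)` on a finite weighted set and `Z = A + B`,
`∑_z P(Z = z) d[(A | Z = z) ; (B | Z = z)] ≤ 3 I[A : B] + 2 H[Z] - H[A] - H[B]`.
The proof is the printed one: two conditionally independent trials `(A₁, B₁), (A₂, B₂)` of
`(A, B)` relative to `Z`, realised on the index set `{(i, j) ∈ s × s : Z i = Z j}` with weights
`w i w j / w({Z = Z i})`, and submodularity `H[A₁ - B₂] + H[A₁ - B₂, A₁, B₁] ≤
H[A₁ - B₂, A₁] + H[A₁ - B₂, B₁]` ((A.17)–(A.20)). [cite: GowersEtAl2025, Lemma A.2] -/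
theorem ent_bsg (hw : ∀ i ∈ s, 0 ≤ w i) (hs : 0 < mass s w) :
    ∑ z ∈ s.image (fun i => A i + B i), prob s w (fun i => A i + B i) z *
        rdist (s.filter fun i => A i + B i = z) w A (s.filter fun i => A i + B i = z) w B ≤
      3 * mutualInfo s w A B + 2 * ent s w (fun i => A i + B i) - ent s w A - ent s w B := by
  classical
  -- notation: `Z`, its fibres `F z`, the trial space `Ω` with weights `v`, and `Z'` on `Ω`
  set Z : ι → G := fun i => A i + B i with hZ
  set F : G → Finset ι := fun z => s.filter fun i => Z i = z with hF
  set Ω : Finset (ι × ι) := (s ×ˢ s).filter fun p => Z p.1 = Z p.2 with hΩ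
  set v : ι × ι → ℝ := fun p => w p.1 * w p.2 / mass (F (Z p.1)) w with hv
  set Z' : ι × ι → G := fun p => Z p.1 with hZ'
  have hF_nonneg : ∀ z, ∀ i ∈ F z, 0 ≤ w i := fun z i hi => hw i (mem_of_mem_filter i hi)
  have hpZ : ∀ z, prob s w Z z = mass (F z) w / mass s w := fun z => rfl
  ----------------------------------------------------------------------------------------------
  -- Part I: the trial space
  ----------------------------------------------------------------------------------------------
  have hmem : ∀ p, p ∈ Ω ↔ p.1 ∈ s ∧ p.2 ∈ s ∧ Z p.1 = Z p.2 := fun p => by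
    simp only [hΩ, mem_filter, mem_product, and_assoc]
  have hv_nonneg : ∀ p ∈ Ω, 0 ≤ v p := by
    intro p hp
    rw [hmem] at hp
    exact div_nonneg (mul_nonneg (hw _ hp.1) (hw _ hp.2.1)) (mass_nonneg (hF_nonneg _))
  -- fibres of `Ω` over `Z' = z` are squares of fibres of `s`
  have hfib : ∀ z, Ω.filter (fun p => Z' p = z) = F z ×ˢ F z := by
    intro z
    ext p
    simp only [hΩ, hF, hZ', mem_filter, mem_product]
    constructor
    · rintro ⟨⟨⟨h1, h2⟩, h3⟩, h4⟩; exact ⟨⟨h1, h4⟩, h2, h3 ▸ h4⟩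
    · rintro ⟨⟨h1, h2⟩, h3, h4⟩; exact ⟨⟨⟨h1, h3⟩, h2.trans h4.symm⟩, h2⟩
  -- probabilities on a fibre are those of the product fibre with product weights
  have hprobfib : ∀ {α : Type u} [DecidableEq α] (X : ι × ι → α) (z : G) (a : α),
      prob (Ω.filter fun p => Z' p = z) v X a = prob (F z ×ˢ F z) (prodW w w) X a := by
    intro α _ X z a
    rw [hfib]
    rcases eq_or_ne (mass (F z) w) 0 with h0 | hne
    · have h1 : mass (F z ×ˢ F z) (prodW w w) = 0 := by rw [mass_prod, h0, mul_zero]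
      have h2 : mass (F z ×ˢ F z) v = 0 := by
        rw [mass_def]
        refine sum_eq_zero fun p hp => ?_
        have : Z p.1 = z := (mem_filter.1 (mem_product.1 hp).1).2
        simp only [hv, this, h0, div_zero]
      rw [prob_eq_zero_of_mass_eq_zero h1, prob_eq_zero_of_mass_eq_zero h2]
    · refine prob_congr_smul_weights (c := (mass (F z) w)⁻¹) (fun p hp => ?_) (inv_ne_zero hne) X a
      have : Z p.1 = z := (mem_filter.1 (mem_product.1 hp).1).2
      simp only [hv, this, prodW_apply, div_eq_inv_mul]
  -- masses of fibres, total mass, law of `Z'`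
  have hmassfib : ∀ z, mass (Ω.filter fun p => Z' p = z) v = mass (F z) w := by
    intro z
    rw [hfib]
    have : mass (F z ×ˢ F z) v = ∑ p ∈ F z ×ˢ F z, prodW w w p / mass (F z) w := by
      rw [mass_def]
      refine sum_congr rfl fun p hp => ?_
      have : Z p.1 = z := (mem_filter.1 (mem_product.1 hp).1).2
      simp only [hv, this, prodW_apply]
    rw [this, ← sum_div, ← mass_def, mass_prod]
    rcases eq_or_ne (mass (F z) w) 0 with h0 | hne
    · rw [h0, mul_zero, zero_div]
    · field_simp
  have himg : Ω.image Z' ⊆ s.image Z := by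
    intro z hz
    obtain ⟨p, hp, rfl⟩ := mem_image.1 hz
    exact mem_image_of_mem _ ((hmem p).1 hp).1
  have hmassΩ : mass Ω v = mass s w := by
    rw [mass_eq_sum_mass_fiber (s := Ω) Z' (t := s.image Z) fun p hp => himg (mem_image_of_mem _ hp),
      mass_eq_sum_mass_fiber (s := s) Z (t := s.image Z) fun i hi => mem_image_of_mem _ hi]
    exact sum_congr rfl fun z _ => hmassfib z
  have hΩpos : 0 < mass Ω v := by rw [hmassΩ]; exact hs
  have hprobZ' : ∀ z, prob Ω v Z' z = prob s w Z z := fun z => by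
    rw [prob_def, prob_def, hmassfib, hmassΩ]
  -- conditional entropies given `Z'` are averages over product fibres
  have hcondEnt : ∀ {α : Type u} [DecidableEq α] (X : ι × ι → α),
      condEnt Ω v X Z' = ∑ z ∈ s.image Z, prob s w Z z * ent (F z ×ˢ F z) (prodW w w) X := by
    intro α _ X
    rw [condEnt_eq_sum_of_subset himg]
    refine sum_congr rfl fun z _ => ?_
    rw [hprobZ']
    congr 1
    rw [ent_def, ent_def]
    have : (Ω.filter fun p => Z' p = z).image X = (F z ×ˢ F z).image X := by rw [hfib]
    rw [this]
    exact sum_congr rfl fun a _ => by rw [hprobfib]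
  -- laws of first- and second-trial variables
  have hprob_fst : ∀ {α : Type u} [DecidableEq α] (X : ι → α) (a : α),
      prob Ω v (fun p => X p.1) a = prob s w X a := by
    intro α _ X a
    rw [prob_eq_sum_prob_pair_left (X := fun p : ι × ι => X p.1) (Y := Z') himg,
      prob_eq_sum_prob_pair_left (X := X) (Y := Z) subset_rfl]
    refine sum_congr rfl fun z _ => ?_
    rw [prob_pair_eq_mul hv_nonneg, prob_pair_eq_mul hw, hprobZ', hprobfib]
    rcases eq_or_ne (mass (F z) w) 0 with h0 | hne
    · rw [hpZ, h0, zero_div, zero_mul, zero_mul]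
    · rw [prob_prod_fst X hne]
  have hprob_snd : ∀ {α : Type u} [DecidableEq α] (X : ι → α) (a : α),
      prob Ω v (fun p => X p.2) a = prob s w X a := by
    intro α _ X a
    rw [prob_eq_sum_prob_pair_left (X := fun p : ι × ι => X p.2) (Y := Z') himg,
      prob_eq_sum_prob_pair_left (X := X) (Y := Z) subset_rfl]
    refine sum_congr rfl fun z _ => ?_
    rw [prob_pair_eq_mul hv_nonneg, prob_pair_eq_mul hw, hprobZ', hprobfib]
    rcases eq_or_ne (mass (F z) w) 0 with h0 | hne
    · rw [hpZ, h0, zero_div, zero_mul, zero_mul]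
    · rw [prob_prod_snd X hne]
  ----------------------------------------------------------------------------------------------
  -- Part II: the entropy computation
  ----------------------------------------------------------------------------------------------
  -- the trial variables
  set A₁ : ι × ι → G := fun p => A p.1 with hA₁
  set B₁ : ι × ι → G := fun p => B p.1 with hB₁
  set A₂ : ι × ι → G := fun p => A p.2 with hA₂
  set B₂ : ι × ι → G := fun p => B p.2 with hB₂
  -- (A.16'): the left-hand side as `H[A₁ + B₂ | Z'] - H[A | Z]/2 - H[B | Z]/2`
  have hLHS : ∑ z ∈ s.image Z, prob s w Z z * rdist (F z) w A (F z) w B =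
      condEnt Ω v (fun p => A₁ p + B₂ p) Z' - condEnt s w A Z / 2 - condEnt s w B Z / 2 := by
    rw [hcondEnt, condEnt_def, condEnt_def, sum_div, sum_div, ← sum_sub_distrib,
      ← sum_sub_distrib]
    refine sum_congr rfl fun z _ => ?_
    rcases eq_or_ne (mass (F z) w) 0 with h0 | hne
    · simp only [hpZ, h0, zero_div, zero_mul, sub_zero]
    · have hpos : 0 < mass (F z) w := lt_of_le_of_ne (mass_nonneg (hF_nonneg z)) hne.symm
      rw [rdist_eq_ent_prod A B hpos hpos]
      ring
  -- (A.20'): `H[A₁ + B₂ | Z'] ≤ H[A₁ + B₂]`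
  have hcond := condEnt_le_ent (X := fun p => A₁ p + B₂ p) (Y := Z') hv_nonneg
  -- (A.17): submodularity
  have hsub := ent_triple_add_ent_le (X := A₁) (Y := B₁) (Z := fun p => A₁ p + B₂ p) hv_nonneg
  -- (A.19): `H[A₁, A₁ + B₂] = H[A₁, B₂] ≤ H[A] + H[B]`
  have h19 : ent Ω v (fun p => (A₁ p, A₁ p + B₂ p)) ≤ ent s w A + ent s w B := by
    have e : ent Ω v (fun p => (A₁ p, A₁ p + B₂ p)) = ent Ω v (fun p => (A₁ p, B₂ p)) := by
      refine ent_eq_of_determines hv_nonneg fun p _ q _ => ?_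
      simp only [Prod.mk.injEq]
      constructor
      · rintro ⟨h1, h2⟩; exact ⟨h1, by linear_combination (norm := abel) h2 - h1⟩
      · rintro ⟨h1, h2⟩; exact ⟨h1, by rw [h1, h2]⟩
    rw [e, ← ent_eq_of_prob_eq (hprob_fst A), ← ent_eq_of_prob_eq (hprob_snd B)]
    exact ent_pair_le_add hv_nonneg
  -- (A.20): `H[B₁, A₁ + B₂] = H[A₂, B₁] ≤ H[A] + H[B]` (uses `A₁ + B₁ = A₂ + B₂` on `Ω`)
  have h20 : ent Ω v (fun p => (B₁ p, A₁ p + B₂ p)) ≤ ent s w A + ent s w B := by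
    have e : ent Ω v (fun p => (B₁ p, A₁ p + B₂ p)) = ent Ω v (fun p => (A₂ p, B₁ p)) := by
      refine ent_eq_of_determines hv_nonneg fun p hp q hq => ?_
      have hp' := ((hmem p).1 hp).2.2
      have hq' := ((hmem q).1 hq).2.2
      simp only [hZ] at hp' hq'
      simp only [Prod.mk.injEq, hA₁, hA₂, hB₁, hB₂]
      constructor
      · rintro ⟨h1, h2⟩
        exact ⟨by linear_combination (norm := abel) h2 + h1 - hp' + hq' - add_self_char2 (B p.2) +
          add_self_char2 (B q.2), h1⟩
      · rintro ⟨h1, h2⟩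
        exact ⟨h2, by linear_combination (norm := abel) hp' - hq' + h1 - h2 + add_self_char2 (B p.2) -
          add_self_char2 (B q.2)⟩
    rw [e, ← ent_eq_of_prob_eq (hprob_snd A), ← ent_eq_of_prob_eq (hprob_fst B)]
    exact ent_pair_le_add hv_nonneg
  -- (A.18): `H[A₁, B₁, A₁ + B₂] = H[A₁, B₁, A₂, B₂] = 2 H[A, B] - H[Z]`
  have h18 : ent Ω v (fun p => (A₁ p, B₁ p, A₁ p + B₂ p)) =
      2 * ent s w (fun i => (A i, B i)) - ent s w Z := by
    -- `V = ((A₁, B₁), (A₂, B₂))`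
    set V : ι × ι → (G × G) × (G × G) := fun p => ((A p.1, B p.1), (A p.2, B p.2)) with hV
    have e1 : ent Ω v (fun p => (A₁ p, B₁ p, A₁ p + B₂ p)) = ent Ω v V := by
      refine ent_eq_of_determines hv_nonneg fun p hp q hq => ?_
      have hp' := ((hmem p).1 hp).2.2
      have hq' := ((hmem q).1 hq).2.2
      simp only [hZ] at hp' hq'
      simp only [Prod.mk.injEq, hA₁, hB₁, hB₂, hV]
      constructor
      · rintro ⟨h1, h2, h3⟩
        have hb2 : B p.2 = B q.2 := by linear_combination (norm := abel) h3 - h1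
        exact ⟨⟨h1, h2⟩, by linear_combination (norm := abel) h1 + h2 + hq' - hp' - hb2, hb2⟩
      · rintro ⟨⟨h1, h2⟩, h3, h4⟩
        exact ⟨h1, h2, by rw [h1, h4]⟩
    -- `H[V] = H[V, Z'] = H[Z'] + H[V | Z']`
    have e2 : ent Ω v V = ent Ω v Z' + condEnt Ω v V Z' := by
      rw [← ent_pair_eq_add_condEnt hv_nonneg]
      refine (ent_pair_eq_of_determines fun p _ q _ h => ?_).symm
      simp only [hV, Prod.mk.injEq] at h
      simp only [hZ', hZ]
      rw [h.1.1, h.1.2]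
    -- `H[Z'] = H[Z]`
    have e3 : ent Ω v Z' = ent s w Z := ent_eq_of_prob_eq hprobZ'
    -- `H[V | Z'] = 2 H[A, B | Z]`
    have e4 : condEnt Ω v V Z' = 2 * condEnt s w (fun i => (A i, B i)) Z := by
      rw [hcondEnt, condEnt_def, mul_sum]
      refine sum_congr rfl fun z _ => ?_
      rcases eq_or_ne (mass (F z) w) 0 with h0 | hne
      · simp only [hpZ, h0, zero_div, zero_mul, mul_zero]
      · have hpos : 0 < mass (F z) w := lt_of_le_of_ne (mass_nonneg (hF_nonneg z)) hne.symm
        have hind := indepRV_prod (s := F z) (w := w) (t := F z) (v := w)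
          (fun i => (A i, B i)) (fun i => (A i, B i))
        have := hind.ent_pair_eq_add (mass_prod_pos hpos hpos)
        rw [ent_prod_fst (fun i => (A i, B i)) hpos, ent_prod_snd (fun i => (A i, B i)) hpos] at this
        rw [show ent (F z ×ˢ F z) (prodW w w) V = _ from this]
        ring
    -- `H[A, B | Z] = H[A, B] - H[Z]`
    have e5 : condEnt s w (fun i => (A i, B i)) Z = ent s w (fun i => (A i, B i)) - ent s w Z := by
      rw [condEnt_eq_ent_pair_sub hw, ent_pair_eq_of_determines]
      intro i _ j _ h
      simp only [Prod.mk.injEq] at h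
      simp only [hZ]
      rw [h.1, h.2]
    rw [e1, e2, e3, e4, e5]
    ring
  -- `H[A | Z] = H[B | Z] = H[A, B] - H[Z]`
  have hAZ : condEnt s w A Z = ent s w (fun i => (A i, B i)) - ent s w Z := by
    rw [condEnt_eq_ent_pair_sub hw]
    congr 1
    refine ent_eq_of_determines hw fun i _ j _ => ?_
    simp only [Prod.mk.injEq, hZ]
    constructor
    · rintro ⟨h1, h2⟩; exact ⟨h1, by linear_combination (norm := abel) h2 - h1⟩
    · rintro ⟨h1, h2⟩; exact ⟨h1, by rw [h1, h2]⟩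
  have hBZ : condEnt s w B Z = ent s w (fun i => (A i, B i)) - ent s w Z := by
    rw [condEnt_eq_ent_pair_sub hw]
    congr 1
    refine ent_eq_of_determines hw fun i _ j _ => ?_
    simp only [Prod.mk.injEq, hZ]
    constructor
    · rintro ⟨h1, h2⟩; exact ⟨by linear_combination (norm := abel) h2 - h1, h1⟩
    · rintro ⟨h1, h2⟩; exact ⟨h2, by rw [h1, h2]⟩
  -- assemble
  rw [hLHS, mutualInfo_def, hAZ, hBZ]
  linarith [hcond, hsub, h19, h20, h18]

end EntropicRuzsa

end Literature.Combinatorics.Additive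

end
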